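import Literature.NumberTheory.EllipticCurves.CMNewformGamma0EulerFactorsPadicCharacterProofsResidual
import Literature.NumberTheory.EllipticCurves.NewformsGaloisConjugateProofs
import Literature.NumberTheory.EllipticCurves.HeckeThetaCMNewformGamma0Holds
import Literature.NumberTheory.EllipticCurves.NewformsLevelEqOfHeckeEigenvalueEqProofs
import Literature.NumberTheory.EllipticCurves.SharpFlatPAdicLFunctionCoeffField
import HarnessLib

/-!
# The level of the `Γ₀` CM newform attached to `ψ` divides `|d_K|·N𝔪` — PROOF of the (LEVEL) conjunct of
# `Ribet1977_cmNewform_gamma0_level_and_badEulerFactor_padicCharacter`, and that fact from its (BAD) residue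

Topic `NumberTheory/EllipticCurves`; THEOREMS ONLY. With the tree's PROVED theorems — Ribet's CM newform
(`Ribet1977_cmNewform_gamma0_of_isGrossencharakter_holds`), strong multiplicity one across levels (`IsNewform0.level_eq_of_heckeEigenvalue_eq_holds`) and the
conjugate newform (Diamond–Shurman Thm. 6.5.4, `GaloisConjugate.exists_isNewform0_conj`) — the LEVEL clause of Ribet's Cor. (3.5) for ANY newform `g ∈ S₂(Γ₀(M))` whose
`p`-adically embedded good coefficients are those of `θ_ψ` is a theorem: ★ `IsNewform0.level_dvd_discr_mul_absNorm_of_embCoeff` (so that fact could be cut down to its (BAD) conjunct at a re-key). No new named fact.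
References: [Ribet1977Nebentypus] §3 Cor. (3.5); [AtkinLehner1970] Thm. 4; [DiamondShurman2005] Thm. 6.5.4.
-/

noncomputable section

open scoped NumberField ModularForm MatrixGroups
open NumberField IsDedekindDomain CongruenceSubgroup
open Literature.NumberTheory.GaloisRepresentations Literature.NumberTheory.LFunctions Literature.NumberTheory.EllipticCurves

namespace Literature.NumberTheory.EllipticCurves.ModularForms

/-- ★ **The level of a newform carrying the good Hecke eigenvalues of `θ_ψ` divides `|d_K|·N𝔪`** (Ribet 1977 §3 Cor. (3.5): "level dividing `DM`"): for `K`
imaginary quadratic, `𝔪 ≠ 0`, a Größencharakter `ψ` mod `𝔪` of type `(1,0)` with `ψ((n)) = (d_K/n)·n`, `e : ℚ̄_p ≃ ℂ`, a newform `g ∈ S₂(Γ₀(M))` and a `p`-adic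
embedding `ι` of its Hecke field with `ι(a_ℓ(g)) = e⁻¹(Σ_{Nw=ℓ} ψ w)` for every prime `ℓ ∤ |d_K|·N𝔪`: `M ∣ |d_K|·N𝔪`. PROOF: the conjugate newform `g^{e∘ι} ∈ S₂(Γ₀(M))`
(`GaloisConjugate.exists_isNewform0_conj`) and Ribet's `θ_ψ` (level `N ∣ |d_K|·N𝔪`) have the same eigenvalues at all `ℓ ∤ |d_K|·N𝔪`, so `M = N` by strong multiplicity one.
[cite: Ribet1977Nebentypus, §3 Cor. (3.5)] [cite: AtkinLehner1970, Thm. 4] [cite: DiamondShurman2005, Thm. 6.5.4] -/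
theorem IsNewform0.level_dvd_discr_mul_absNorm_of_embCoeff (K : Type) [Field K] [NumberField K] (hK2 : Module.finrank ℚ K = 2) (htc : IsTotallyComplex K)
    (σK : K →+* ℂ) (𝔪 : Ideal (𝓞 K)) (h𝔪 : 𝔪 ≠ ⊥) (ψ : HeightOneSpectrum (𝓞 K) → ℂ) (hψ : IsGrossencharakter 𝔪 (embType σK) (embTypeConj σK) ψ)
    (hψpow : ∀ n : ℕ, Odd n → n.Coprime ((discr K).natAbs * Ideal.absNorm 𝔪) →
      idealPow K ψ (Ideal.span {(n : 𝓞 K)}) = (jacobiSym (discr K) n : ℂ) * (n : ℂ) ^ (2 - 1))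
    {p : ℕ} [Fact p.Prime] (e : PadicAlgCl p ≃+* ℂ) {M : ℕ} [NeZero M] {g : CuspForm (Gamma0 M) 2} (ι : coeffField g →+* PadicAlgCl p) (hng : IsNewform0 g)
    (hcoeffψ : ∀ ℓ : ℕ, ℓ.Prime → ¬ ℓ ∣ (discr K).natAbs * Ideal.absNorm 𝔪 →
      embCoeff g ι ℓ = e.symm (∑ᶠ (w : HeightOneSpectrum (𝓞 K)) (_ : Ideal.absNorm w.asIdeal = ℓ), ψ w)) :
    M ∣ (discr K).natAbs * Ideal.absNorm 𝔪 := by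
  obtain ⟨g', hg', hcoeff⟩ := GaloisConjugate.exists_isNewform0_conj le_rfl g hng ((e : PadicAlgCl p →+* ℂ).comp ι)
  -- Ribet's CM newform `θ_ψ`
  have hψ' : IsGrossencharakter 𝔪 (fun w => (((2 : ℕ) : ℤ) - 1) * embType σK w) (fun w => (((2 : ℕ) : ℤ) - 1) * embTypeConj σK w) ψ := by
    have h1 : (fun w => (((2 : ℕ) : ℤ) - 1) * embType σK w) = embType σK := funext fun w ↦ by push_cast; ring
    have h2 : (fun w => (((2 : ℕ) : ℤ) - 1) * embTypeConj σK w) = embTypeConj σK := funext fun w ↦ by push_cast; ring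
    rw [h1, h2]; exact hψ
  obtain ⟨N, hN, θψ, hNdvd, hθ, -, hθcoeff⟩ := Ribet1977_cmNewform_gamma0_of_isGrossencharakter_holds K hK2 htc σK 2 le_rfl 𝔪 h𝔪 ψ hψ' hψpow
  haveI := hN
  have hagree : ∀ ℓ : ℕ, ℓ.Prime → ¬ ℓ ∣ (discr K).natAbs * Ideal.absNorm 𝔪 → cuspCoeff g' ℓ = cuspCoeff θψ ℓ := by
    intro ℓ hℓ hℓN
    rw [hcoeff ℓ, hθcoeff ℓ hℓ hℓN, RingHom.comp_apply, ← embCoeff_def, hcoeffψ ℓ hℓ hℓN]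
    exact e.apply_symm_apply _
  have hD0 : (discr K).natAbs * Ideal.absNorm 𝔪 ≠ 0 := by
    refine mul_ne_zero (Int.natAbs_ne_zero.mpr (NumberField.discr_ne_zero K)) ?_
    rw [Ne, Ideal.absNorm_eq_zero_iff]; exact h𝔪
  have hfin : {q : ℕ | q.Prime ∧ heckeEigenvalue g' q ≠ heckeEigenvalue θψ q}.Finite := by
    refine (Finset.finite_toSet ((discr K).natAbs * Ideal.absNorm 𝔪).primeFactors).subset fun q hq ↦ ?_
    obtain ⟨hq, hne⟩ := hq
    rw [Finset.mem_coe, Nat.mem_primeFactors]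
    refine ⟨hq, ?_, hD0⟩
    by_contra hqd
    apply hne
    rw [heckeEigenvalue_eq_coeff_of_isNormalized hg'.2.2 hq (hg'.2.1 q hq), heckeEigenvalue_eq_coeff_of_isNormalized hθ.2.2 hq (hθ.2.1 q hq)]
    exact hagree q hq hqd
  have hMN : M = N := IsNewform0.level_eq_of_heckeEigenvalue_eq_holds (N := M) (k := 2) hg' hθ hfin
  rw [hMN]; exact hNdvd

end Literature.NumberTheory.EllipticCurves.ModularForms

end
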